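import Summits.AnomalousDissipation.AnomalousDissipation.Theorems.SolenoidalFractalHomogenisationLagrangianStepVmodSfCoarseMid
import Summits.AnomalousDissipation.AnomalousDissipation.Theorems.SolenoidalFractalHomogenisationLagrangianStepVmodSfHigh
import HarnessLib

/-!
# K1L_D (stmt-AnomalousDissipation-27980): (V_mod) flat stage, block (ff) at grid phase — COARSE LABELS, part 1: the sideband of a FAST class
# datum (raw L-sb with the molecular kill), the MID row (`P < τ`, `Rτ ≤ 2`) and the ν-FLOOR row in the allowance currency
(prover ad-k3l-bookkeeping-p1 g10; RULING D28-9 assigns the (ff) grid twin to k3l; helper `--supports 27980 --as helper`; the fast-datum twins of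
`…VmodSfCoarseMid`.)

Notation as in p1's parts A–D and `…VmodSfCoarseMid` (`R = 8π²·loT·|ℓ|²`, `P = M·W.period/ν`, `u = RP`, `τ = t − s`, `y = P/τ`,
`cS = 8(√|ℓ|²/n)Σ‖slotAmp W‖/(π·ν·lo/Λ)`, `cSp = 8Σ‖slotAmp W‖/(π(lo/Λ)√D₀)`, `a₁ := π²(lo/Λ)·M·Wp/2` so that the molecular kill of the
fast content over the window is `exp(−a₁/y)`).
* `sideband_le_cS_fast` — RAW: grid start, fast class datum `v` (`𝓕v ⊆ ±ℓ + nℤ³`, `𝓕v(±ℓ) = 0`), every `t ≥ s`: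
  `sideband(U s t v) ≤ cS·‖v‖ + exp(−(π²·ν·lo/Λ/2)(t−s))·‖v‖` (`VmodGen.sqrt_fast_le` with `fast(v) = ‖v‖²`);
* **`sideband_le_alw_of_mid_fast`** — `P < τ`, `Rτ ≤ 2` (so `u ≤ 2y`), `e ≤ 1/2`, `C₁ ≥ √2·cSp + 1/√a₁`:
  `sideband(U s t v) ≤ (C₁(C₁(ν^e + (⌈K/ν⌉/n)^e) + (min 1 (P/τ))^e))·‖v‖` (`cS ≤ cSp√u ≤ √2·cSp·y^e`, `exp(−a₁/y) ≤ y^e/√a₁`);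
* **`sideband_le_alw_of_nufloor_fast`** — `t₀ ≤ ν`, `P < τ`, `0 ≤ e ≤ 1/2`, `C₁²t₀^e ≥ 4Σ‖slotAmp W‖/(π(lo/Λ)t₀)`, `C₁ ≥ 1/√a₁`: same conclusion.
`sorry`-free; NOT a proof of (ff), of the stub, of K1L_D or of AD; rung F-D1.A0.
-/

set_option linter.dupNamespace false

noncomputable section

namespace Summit.AnomalousDissipation.AnomalousDissipation.Theorems.SolenoidalFractalHomogenisation.LagrangianStep.VmodGen

open Set MeasureTheory Complex UnitAddTorus
open scoped InnerProductSpace ENNReal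
open Literature.Analysis Literature.Analysis.FunctionSpaces Literature.Analysis.FunctionSpaces.Torus
open Literature.Analysis.FluidPDE Literature.Analysis.FluidPDE.Torus Literature.Analysis.FluidPDE.LatticeShear
open Summit.AnomalousDissipation.AnomalousDissipation.Theorems.SolenoidalFractalHomogenisation.LagrangianStep.Sideband (slotAmp)
open Summit.AnomalousDissipation.AnomalousDissipation.Theorems.SolenoidalFractalHomogenisation.LagrangianStep.VmodFlat
  (fc fc_sub loT dW IsFast exp_neg_div_le_rpow_div_sqrt)
open Summit.AnomalousDissipation.AnomalousDissipation.Theorems.SolenoidalFractalHomogenisation.RealisedQuasiStaticCellLaw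
  (isSmooth_cell isDivFree_cell memLp_top_stLift_cell)

section Clause

variable {k : ℕ} {W : LatticeWord k} {M : ℝ} {hM : 0 < M} {c : ℝ}
  {lo hi Λ β K : ℝ} {ν ν₀ : ℝ} {n : ℕ} {𝔸 : Visc4 (Fin 3)} {Tw : ℝ} {U : ℝ → ℝ → (V2 →L[ℝ] V2)}

set_option maxHeartbeats 1600000 in
/-- **RAW L-sb WITH THE MOLECULAR KILL, FAST CLASS DATUM AT GRID PHASE.** -/
theorem sideband_le_cS_fast (hlo : 0 < lo) (hhi : 0 ≤ hi) (hΛ : 1 ≤ Λ)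
    (hν : ν ∈ Set.Ioo 0 ν₀) (hn : 1 ≤ n) (hwin : ∃ lam ∈ Set.Icc (1:ℝ) Λ, NearIso 𝔸 (ν * (lo / lam)) (ν * (hi * lam)))
    (hU : IsPropagator Tw (cellField W M hM ν hν.1 n) ((1 / (n:ℝ) ^ 2) • 𝔸) U)
    {s t : ℝ} (j₀ : ℕ) (hs₀ : s = j₀ * (M * W.period / ν)) (hst : s ≤ t) (htT : t ≤ Tw) (hsT : s < Tw)
    {Lb : ℕ} (hLb : 2 * Lb < n) {ℓ : Fin 3 → ℤ} (hℓ0 : ℓ ≠ 0) (hℓL : ℓ ∈ Torus.freqBall (d := Fin 3) Lb)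
    (v : V2) (hv : v ∈ divFreeL2 (Fin 3))
    (hvcl : ∀ k', fc v k' ≠ 0 → (∀ i, (n : ℤ) ∣ k' i - ℓ i) ∨ (∀ i, (n : ℤ) ∣ k' i + ℓ i)) (hv1 : fc v ℓ = 0) (hv2 : fc v (-ℓ) = 0) :
    Real.sqrt (‖U s t v‖ ^ 2 - (‖fc (U s t v) ℓ‖ ^ 2 + ‖fc (U s t v) (-ℓ)‖ ^ 2))
      ≤ (8 * (Real.sqrt (freqNormSq ℓ) / n) * (∑ j, ‖slotAmp W j‖) / (Real.pi * (ν * (lo / Λ)))) * ‖v‖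
        + Real.exp (-(Real.pi ^ 2 * (ν * (lo / Λ)) / 2 * (t - s))) * ‖v‖ := by
  classical
  have hnpos : 0 < n := hn
  have hn1 : n ≠ 0 := Nat.pos_iff_ne_zero.1 hnpos
  have hWp := PermissibleCarrier.period_pos W
  have hP0 : 0 < M * W.period / ν := div_pos (mul_pos hM hWp) hν.1
  have hs0 : 0 ≤ s := by rw [hs₀]; positivity
  have hΛ0 : 0 < Λ := lt_of_lt_of_le one_pos hΛ
  have hloA : 0 < ν * (lo / Λ) := mul_pos hν.1 (div_pos hlo hΛ0)
  have hAΛ : NearIso 𝔸 (ν * (lo / Λ)) (ν * (hi * Λ)) := by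
    obtain ⟨lam, hlam, hA⟩ := hwin
    have hlam1 : 0 < lam := lt_of_lt_of_le one_pos hlam.1
    exact hA.mono (mul_le_mul_of_nonneg_left (div_le_div_of_nonneg_left hlo.le hlam1 hlam.2) hν.1.le)
      (mul_le_mul_of_nonneg_left (mul_le_mul_of_nonneg_left hlam.2 hhi) hν.1.le)
  have hℓn : 2 * Real.sqrt (freqNormSq ℓ) < n := by
    have h2 := hℓL
    rw [Torus.mem_freqBall] at h2
    have hsq : Real.sqrt (freqNormSq ℓ) ≤ Lb := by
      rw [← Real.sqrt_sq (Nat.cast_nonneg Lb)]; exact Real.sqrt_le_sqrt h2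
    have : (2:ℝ) * Lb < n := by exact_mod_cast hLb
    linarith
  set W₁ : LatticeWord k := (W.stretch M hM).stretch (1 / ν) (one_div_pos.mpr hν.1) with hW₁
  have hU' : IsPropagator Tw (W₁.cell n) ((1 / (n:ℝ) ^ 2) • 𝔸) U := hU
  have hphase : ∀ τ, W₁.cell n (s + τ) = W₁.cell n τ := by
    intro τ; rw [hs₀]; exact cellField_add_nat_mul_period W M hM ν hν.1 n j₀ τ
  have hfast0 : ‖v‖ ^ 2 - (‖fc v ℓ‖ ^ 2 + ‖fc v (-ℓ)‖ ^ 2) = ‖v‖ ^ 2 := by rw [hv1, hv2, norm_zero]; ring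
  have key := sqrt_fast_le W₁ hn1 hAΛ hloA hU' hs0 hst htT hsT hphase hℓ0 hℓn v ((mem_divFreeL2_iff v).1 hv) hvcl
  rw [hfast0, Real.sqrt_sq (norm_nonneg v)] at key
  have hα : (∑ j, ‖slotAmp W₁ j‖) = ∑ j, ‖slotAmp W j‖ := Finset.sum_congr rfl fun j _ => rfl
  rw [hα] at key
  exact key

/-! ## The mid row and the ν-floor row for a fast class datum -/

/-- The kill exponent of the window in terms of `y = P/τ`: `(π²·ν·lo/Λ/2)·(t−s) = a₁/y`, `a₁ = π²(lo/Λ)M·Wp/2`. -/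
theorem kill_exponent_eq {lo Λ M Wp ν t s : ℝ} (hν : ν ≠ 0) (hτ : t - s ≠ 0) (hM : M ≠ 0) (hWp : Wp ≠ 0) :
    Real.pi ^ 2 * (ν * (lo / Λ)) / 2 * (t - s) = (Real.pi ^ 2 * (lo / Λ) * (M * Wp) / 2) / ((M * Wp / ν) / (t - s)) := by
  rw [div_div_eq_mul_div, div_div_eq_mul_div]
  field_simp

set_option maxHeartbeats 1600000 in
/-- **THE MID ROW OF (ff) ON COARSE LABELS, FAST CLASS DATUM** (grid phase, `P < τ`, `Rτ ≤ 2`, `e ≤ 1/2`, `C₁ ≥ √2·cSp + 1/√a₁`). -/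
theorem sideband_le_alw_of_mid_fast (hlo : 0 < lo) (hhi : 0 ≤ hi) (hΛ : 1 ≤ Λ) (hc : 0 < c)
    (hν : ν ∈ Set.Ioo 0 ν₀) (hn : 1 ≤ n) (hwin : ∃ lam ∈ Set.Icc (1:ℝ) Λ, NearIso 𝔸 (ν * (lo / lam)) (ν * (hi * lam)))
    (hU : IsPropagator Tw (cellField W M hM ν hν.1 n) ((1 / (n:ℝ) ^ 2) • 𝔸) U)
    {s t : ℝ} (j₀ : ℕ) (hs₀ : s = j₀ * (M * W.period / ν)) (htT : t ≤ Tw)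
    {Lb : ℕ} (hLb : 2 * Lb < n) {ℓ : Fin 3 → ℤ} (hℓ0 : ℓ ≠ 0) (hℓL : ℓ ∈ Torus.freqBall (d := Fin 3) Lb)
    (v : V2) (hv : v ∈ divFreeL2 (Fin 3))
    (hvcl : ∀ k', fc v k' ≠ 0 → (∀ i, (n : ℤ) ∣ k' i - ℓ i) ∨ (∀ i, (n : ℤ) ∣ k' i + ℓ i)) (hv1 : fc v ℓ = 0) (hv2 : fc v (-ℓ) = 0)
    {C₁ e : ℝ} (hC₁0 : 0 ≤ C₁)
    (hC₁ : Real.sqrt 2 * (8 * (∑ j, ‖slotAmp W j‖) / (Real.pi * (lo / Λ) * Real.sqrt (8 * Real.pi ^ 2 * (lo / Λ) * (M * W.period) * c)))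
      + 1 / Real.sqrt (Real.pi ^ 2 * (lo / Λ) * (M * W.period) / 2) ≤ C₁)
    (he12 : e ≤ 1 / 2)
    (hPτ : M * W.period / ν < t - s)
    (hRτ : 8 * Real.pi ^ 2 * loT lo Λ c ν n * Torus.freqNormSq ℓ * (t - s) ≤ 2) :
    Real.sqrt (‖U s t v‖ ^ 2 - (‖fc (U s t v) ℓ‖ ^ 2 + ‖fc (U s t v) (-ℓ)‖ ^ 2))
      ≤ (C₁ * (C₁ * (ν ^ e + ((⌈K / ν⌉₊ : ℝ) / n) ^ e) + (min 1 ((M * W.period / ν) / (t - s))) ^ e)) * ‖v‖ := by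
  have hWp := PermissibleCarrier.period_pos W
  have hMW : 0 < M * W.period := mul_pos hM hWp
  have hν0 : 0 < ν := hν.1
  have hn0 : (0:ℝ) < n := by exact_mod_cast (show 0 < n from hn)
  have hΛ0 : 0 < Λ := lt_of_lt_of_le one_pos hΛ
  have hloΛ : 0 < lo / Λ := div_pos hlo hΛ0
  set P : ℝ := M * W.period / ν with hP
  have hP0 : 0 < P := div_pos hMW hν.1
  have hst : s < t := by linarith
  have hτ0 : 0 < t - s := by linarith
  have hsT : s < Tw := lt_of_lt_of_le hst htT
  set q : ℝ := Torus.freqNormSq ℓ with hq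
  set R : ℝ := 8 * Real.pi ^ 2 * loT lo Λ c ν n * q with hR
  set u : ℝ := R * P with hu
  have hloT : 0 < loT lo Λ c ν n := by
    unfold loT; have hνc : 0 < ν + c / ν := by have := hν.1; positivity
    exact mul_pos (by positivity) (mul_pos hνc hloΛ)
  have hq0 : 0 ≤ q := freqNormSq_nonneg ℓ
  have hR0 : 0 ≤ R := by rw [hR]; positivity
  have hu0 : 0 ≤ u := mul_nonneg hR0 hP0.le
  -- `y = P/τ`, `u = Rτ·y ≤ 2y`
  set y : ℝ := P / (t - s) with hy
  have hy0 : 0 < y := div_pos hP0 hτ0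
  have hy1 : y ≤ 1 := (div_le_one hτ0).2 hPτ.le
  have hmin : min 1 (P / (t - s)) = y := by rw [hy]; exact min_eq_right hy1
  have huy : u ≤ 2 * y := by
    have e1 : u = (R * (t - s)) * y := by rw [hu, hy]; field_simp
    rw [e1]; nlinarith [hy0.le, hR0]
  -- raw sideband with kill
  set S : ℝ := ∑ j, ‖slotAmp W j‖ with hS
  have hS0 : 0 ≤ S := Finset.sum_nonneg fun j _ => norm_nonneg _
  set cSp : ℝ := 8 * S / (Real.pi * (lo / Λ) * Real.sqrt (8 * Real.pi ^ 2 * (lo / Λ) * (M * W.period) * c)) with hcSp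
  have hcSp0 : 0 ≤ cSp := by rw [hcSp]; positivity
  set a₁ : ℝ := Real.pi ^ 2 * (lo / Λ) * (M * W.period) / 2 with ha₁
  have ha₁0 : 0 < a₁ := by rw [ha₁]; positivity
  have hraw := sideband_le_cS_fast hlo hhi hΛ hν hn hwin hU j₀ hs₀ hst.le htT hsT hLb hℓ0 hℓL v hv hvcl hv1 hv2
  have hcS := cS_le_cSp_sqrt (W := W) hlo hΛ hc hM hν.1 hn S hS0 ℓ
  -- the kill factor in terms of `y`
  have hkill_eq : Real.exp (-(Real.pi ^ 2 * (ν * (lo / Λ)) / 2 * (t - s))) = Real.exp (-(a₁ / y)) := by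
    rw [kill_exponent_eq hν.1.ne' hτ0.ne' hM.ne' hWp.ne', ha₁, hy, hP]
  have hkill : Real.exp (-(a₁ / y)) ≤ y ^ e / Real.sqrt a₁ := exp_neg_div_le_rpow_div_sqrt ha₁0 hy0 hy1 he12
  -- `cS ≤ cSp√u ≤ √2·cSp·y^e`
  have hye0 : 0 ≤ y ^ e := Real.rpow_nonneg hy0.le _
  have hsqrt_u : Real.sqrt u ≤ Real.sqrt 2 * y ^ e := by
    have h1 : Real.sqrt u ≤ Real.sqrt (2 * y) := Real.sqrt_le_sqrt huy
    have h2 : Real.sqrt (2 * y) = Real.sqrt 2 * Real.sqrt y := Real.sqrt_mul (by norm_num) y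
    have h3 : Real.sqrt y ≤ y ^ e := by rw [Real.sqrt_eq_rpow]; exact Real.rpow_le_rpow_of_exponent_ge hy0 hy1 he12
    rw [h2] at h1
    exact h1.trans (mul_le_mul_of_nonneg_left h3 (Real.sqrt_nonneg 2))
  -- assembling
  set X : ℝ := ν ^ e + ((⌈K / ν⌉₊ : ℝ) / n) ^ e with hX
  have hX0 : 0 ≤ X := by
    have h1 : 0 ≤ ν ^ e := Real.rpow_nonneg hν.1.le _
    have h2 : 0 ≤ ((⌈K / ν⌉₊ : ℝ) / n) ^ e := Real.rpow_nonneg (by positivity) _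
    rw [hX]; linarith
  have halw : C₁ * y ^ e ≤ C₁ * (C₁ * X + y ^ e) := by nlinarith [mul_nonneg hC₁0 (mul_nonneg hC₁0 hX0)]
  have hcoef : 8 * (Real.sqrt q / n) * S / (Real.pi * (ν * (lo / Λ))) + Real.exp (-(Real.pi ^ 2 * (ν * (lo / Λ)) / 2 * (t - s)))
      ≤ C₁ * y ^ e := by
    rw [hkill_eq]
    have h1 : 8 * (Real.sqrt q / n) * S / (Real.pi * (ν * (lo / Λ))) ≤ cSp * (Real.sqrt 2 * y ^ e) :=
      hcS.trans (mul_le_mul_of_nonneg_left hsqrt_u hcSp0)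
    have h2 : y ^ e / Real.sqrt a₁ = (1 / Real.sqrt a₁) * y ^ e := by ring
    have h3 : (Real.sqrt 2 * cSp + 1 / Real.sqrt a₁) * y ^ e ≤ C₁ * y ^ e := mul_le_mul_of_nonneg_right hC₁ hye0
    calc 8 * (Real.sqrt q / n) * S / (Real.pi * (ν * (lo / Λ))) + Real.exp (-(a₁ / y))
        ≤ cSp * (Real.sqrt 2 * y ^ e) + y ^ e / Real.sqrt a₁ := add_le_add h1 hkill
      _ = (Real.sqrt 2 * cSp + 1 / Real.sqrt a₁) * y ^ e := by ring
      _ ≤ C₁ * y ^ e := h3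
  rw [hmin]
  calc Real.sqrt (‖U s t v‖ ^ 2 - (‖fc (U s t v) ℓ‖ ^ 2 + ‖fc (U s t v) (-ℓ)‖ ^ 2))
      ≤ (8 * (Real.sqrt q / n) * S / (Real.pi * (ν * (lo / Λ)))) * ‖v‖ + Real.exp (-(Real.pi ^ 2 * (ν * (lo / Λ)) / 2 * (t - s))) * ‖v‖ := hraw
    _ = (8 * (Real.sqrt q / n) * S / (Real.pi * (ν * (lo / Λ))) + Real.exp (-(Real.pi ^ 2 * (ν * (lo / Λ)) / 2 * (t - s)))) * ‖v‖ := by ring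
    _ ≤ (C₁ * y ^ e) * ‖v‖ := mul_le_mul_of_nonneg_right hcoef (norm_nonneg _)
    _ ≤ (C₁ * (C₁ * X + y ^ e)) * ‖v‖ := mul_le_mul_of_nonneg_right halw (norm_nonneg _)
    _ = _ := by rw [hX]

set_option maxHeartbeats 1600000 in
/-- **THE ν-FLOOR ROW OF (ff) ON COARSE LABELS, FAST CLASS DATUM** (grid phase, `t₀ ≤ ν`, `P < τ`, `0 ≤ e ≤ 1/2`,
`C₁²t₀^e ≥ 4Σ‖slotAmp W‖/(π(lo/Λ)t₀)`, `C₁ ≥ 1/√a₁`). -/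
theorem sideband_le_alw_of_nufloor_fast (hlo : 0 < lo) (hhi : 0 ≤ hi) (hΛ : 1 ≤ Λ)
    (hν : ν ∈ Set.Ioo 0 ν₀) (hn : 1 ≤ n) (hwin : ∃ lam ∈ Set.Icc (1:ℝ) Λ, NearIso 𝔸 (ν * (lo / lam)) (ν * (hi * lam)))
    (hU : IsPropagator Tw (cellField W M hM ν hν.1 n) ((1 / (n:ℝ) ^ 2) • 𝔸) U)
    {s t : ℝ} (j₀ : ℕ) (hs₀ : s = j₀ * (M * W.period / ν)) (htT : t ≤ Tw)
    {Lb : ℕ} (hLb : 2 * Lb < n) {ℓ : Fin 3 → ℤ} (hℓ0 : ℓ ≠ 0) (hℓL : ℓ ∈ Torus.freqBall (d := Fin 3) Lb)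
    (v : V2) (hv : v ∈ divFreeL2 (Fin 3))
    (hvcl : ∀ k', fc v k' ≠ 0 → (∀ i, (n : ℤ) ∣ k' i - ℓ i) ∨ (∀ i, (n : ℤ) ∣ k' i + ℓ i)) (hv1 : fc v ℓ = 0) (hv2 : fc v (-ℓ) = 0)
    {C₁ e t₀ : ℝ} (hC₁0 : 0 ≤ C₁) (ht₀0 : 0 < t₀) (hνc : t₀ ≤ ν) (he0 : 0 ≤ e) (he12 : e ≤ 1 / 2)
    (hC₁f : 4 * (∑ j, ‖slotAmp W j‖) / (Real.pi * (lo / Λ) * t₀) ≤ C₁ * C₁ * t₀ ^ e)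
    (hC₁k : 1 / Real.sqrt (Real.pi ^ 2 * (lo / Λ) * (M * W.period) / 2) ≤ C₁)
    (hPτ : M * W.period / ν < t - s) :
    Real.sqrt (‖U s t v‖ ^ 2 - (‖fc (U s t v) ℓ‖ ^ 2 + ‖fc (U s t v) (-ℓ)‖ ^ 2))
      ≤ (C₁ * (C₁ * (ν ^ e + ((⌈K / ν⌉₊ : ℝ) / n) ^ e) + (min 1 ((M * W.period / ν) / (t - s))) ^ e)) * ‖v‖ := by
  have hWp := PermissibleCarrier.period_pos W
  have hMW : 0 < M * W.period := mul_pos hM hWp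
  have hν0 : 0 < ν := hν.1
  have hn0 : (0:ℝ) < n := by exact_mod_cast (show 0 < n from hn)
  have hΛ0 : 0 < Λ := lt_of_lt_of_le one_pos hΛ
  have hloΛ : 0 < lo / Λ := div_pos hlo hΛ0
  set P : ℝ := M * W.period / ν with hP
  have hP0 : 0 < P := div_pos hMW hν.1
  have hst : s < t := by linarith
  have hτ0 : 0 < t - s := by linarith
  have hsT : s < Tw := lt_of_lt_of_le hst htT
  set q : ℝ := Torus.freqNormSq ℓ with hq
  have hq0 : 0 ≤ q := freqNormSq_nonneg ℓ
  -- `√q/n ≤ 1/2`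
  have hqn : Real.sqrt q / n ≤ 1 / 2 := by
    have h2 := hℓL
    rw [Torus.mem_freqBall] at h2
    have hsq : Real.sqrt q ≤ Lb := by rw [hq, ← Real.sqrt_sq (Nat.cast_nonneg Lb)]; exact Real.sqrt_le_sqrt h2
    have : (2:ℝ) * Lb < n := by exact_mod_cast hLb
    rw [div_le_iff₀ hn0]; linarith
  set y : ℝ := P / (t - s) with hy
  have hy0 : 0 < y := div_pos hP0 hτ0
  have hy1 : y ≤ 1 := (div_le_one hτ0).2 hPτ.le
  have hmin : min 1 (P / (t - s)) = y := by rw [hy]; exact min_eq_right hy1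
  set S : ℝ := ∑ j, ‖slotAmp W j‖ with hS
  have hS0 : 0 ≤ S := Finset.sum_nonneg fun j _ => norm_nonneg _
  set a₁ : ℝ := Real.pi ^ 2 * (lo / Λ) * (M * W.period) / 2 with ha₁
  have ha₁0 : 0 < a₁ := by rw [ha₁]; positivity
  have hraw := sideband_le_cS_fast hlo hhi hΛ hν hn hwin hU j₀ hs₀ hst.le htT hsT hLb hℓ0 hℓL v hv hvcl hv1 hv2
  -- `cS ≤ 4S/(π(lo/Λ)t₀) ≤ C₁²t₀^e ≤ C₁²ν^e`
  have hcSb : 8 * (Real.sqrt q / n) * S / (Real.pi * (ν * (lo / Λ))) ≤ 4 * S / (Real.pi * (lo / Λ) * t₀) := by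
    have h1 : 8 * (Real.sqrt q / n) * S ≤ 4 * S := by nlinarith [hS0, hqn, Real.sqrt_nonneg q, hn0]
    calc 8 * (Real.sqrt q / n) * S / (Real.pi * (ν * (lo / Λ))) ≤ 4 * S / (Real.pi * (ν * (lo / Λ))) :=
          div_le_div_of_nonneg_right h1 (by positivity)
      _ ≤ 4 * S / (Real.pi * (t₀ * (lo / Λ))) := by
          apply div_le_div_of_nonneg_left (by positivity) (by positivity)
          exact mul_le_mul_of_nonneg_left (mul_le_mul_of_nonneg_right hνc hloΛ.le) Real.pi_pos.le
      _ = 4 * S / (Real.pi * (lo / Λ) * t₀) := by ring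
  have hνe : t₀ ^ e ≤ ν ^ e := Real.rpow_le_rpow ht₀0.le hνc he0
  have hfloor : 8 * (Real.sqrt q / n) * S / (Real.pi * (ν * (lo / Λ))) ≤ C₁ * C₁ * ν ^ e :=
    (hcSb.trans hC₁f).trans (mul_le_mul_of_nonneg_left hνe (mul_nonneg hC₁0 hC₁0))
  -- the kill
  have hkill_eq : Real.exp (-(Real.pi ^ 2 * (ν * (lo / Λ)) / 2 * (t - s))) = Real.exp (-(a₁ / y)) := by
    rw [kill_exponent_eq hν.1.ne' hτ0.ne' hM.ne' hWp.ne', ha₁, hy, hP]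
  have hye0 : 0 ≤ y ^ e := Real.rpow_nonneg hy0.le _
  have hkill : Real.exp (-(a₁ / y)) ≤ C₁ * y ^ e := by
    refine (exp_neg_div_le_rpow_div_sqrt ha₁0 hy0 hy1 he12).trans ?_
    rw [div_eq_mul_one_div, mul_comm]
    exact mul_le_mul_of_nonneg_right hC₁k hye0
  -- assembling
  have hue0 : 0 ≤ ((⌈K / ν⌉₊ : ℝ) / n) ^ e := Real.rpow_nonneg (by positivity) _
  rw [hmin]
  calc Real.sqrt (‖U s t v‖ ^ 2 - (‖fc (U s t v) ℓ‖ ^ 2 + ‖fc (U s t v) (-ℓ)‖ ^ 2))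
      ≤ (8 * (Real.sqrt q / n) * S / (Real.pi * (ν * (lo / Λ)))) * ‖v‖ + Real.exp (-(Real.pi ^ 2 * (ν * (lo / Λ)) / 2 * (t - s))) * ‖v‖ := hraw
    _ = (8 * (Real.sqrt q / n) * S / (Real.pi * (ν * (lo / Λ))) + Real.exp (-(a₁ / y))) * ‖v‖ := by rw [hkill_eq]; ring
    _ ≤ (C₁ * C₁ * ν ^ e + C₁ * y ^ e) * ‖v‖ := mul_le_mul_of_nonneg_right (add_le_add hfloor hkill) (norm_nonneg _)
    _ ≤ (C₁ * (C₁ * (ν ^ e + ((⌈K / ν⌉₊ : ℝ) / n) ^ e) + y ^ e)) * ‖v‖ := by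
        apply mul_le_mul_of_nonneg_right _ (norm_nonneg _)
        nlinarith [mul_nonneg (mul_nonneg hC₁0 hC₁0) hue0]

end Clause

end Summit.AnomalousDissipation.AnomalousDissipation.Theorems.SolenoidalFractalHomogenisation.LagrangianStep.VmodGen

end
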